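import Mathlib.Analysis.SpecialFunctions.Log.Deriv
import Literature.NumberTheory.Transcendental.SemialgebraicLineDeriv
import Literature.NumberTheory.Transcendental.KZSemialgebraicComplex

/-!
# `LogPrimitiveNL` (stmt-KontsevichZagierPeriods-2836, route LiouvilleUnfolding) — line
`logderiv-peeling`, stub `stub_peelingStep`

One step of the Kolchin–Ostrowski peeling behind the structure theorem for `ℚ`-semialgebraic
log-linear identities. On an OPEN `ℚ`-semialgebraic `U ⊆ ℝⁿ` carry differentiable
`ℚ`-semialgebraic data `φᵢ, Wᵢ > 0, P > 0, γ` with `Σᵢ φᵢ log Wᵢ + log P = γ` on `U`, and fix a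
base direction `eⱼ = Pi.single j 1`. Then

* (a) every partial `x ↦ ∂ⱼφᵢ(x) = fderiv ℝ (φ i) x eⱼ` is `ℚ`-semialgebraic on `U` — partial
  derivatives of semialgebraic functions on open sets are semialgebraic (Basu–Pollack–Roy 2006,
  Prop. 3.22 and the remark following it; in the tree
  `IsSemialgebraicFunOn.fderiv_apply_single`);
* (b) the new right-hand side `∂ⱼγ − Σᵢ φᵢ ∂ⱼWᵢ / Wᵢ − ∂ⱼP / P` is `ℚ`-semialgebraic on `U`
  ((a) for `γ, Wᵢ, P` and closure of semialgebraic functions under `+, −, ×, /`,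
  Bochnak–Coste–Roy 1998, Prop. 2.2.6);
* (c) the differentiated identity `Σᵢ ∂ⱼφᵢ · log Wᵢ = ∂ⱼγ − Σᵢ φᵢ ∂ⱼWᵢ / Wᵢ − ∂ⱼP / P` holds on
  `U`: both sides of the hypothesis agree on the open set `U`, hence have the same Fréchet
  derivative at each of its points, and the left side is differentiated by the sum and product
  rules and `(log ∘ f)' = f' / f` (`HasFDerivAt.log`).

No new definitions, no named facts.

## References

* S. Basu, R. Pollack, M.-F. Roy, *Algorithms in Real Algebraic Geometry*, 2nd ed., Springer
  (2006), §3.5, Prop. 3.22.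
* J. Bochnak, M. Coste, M.-F. Roy, *Real Algebraic Geometry*, Springer (1998), Prop. 2.2.6.
* E. R. Kolchin, *Algebraic groups and algebraic dependence*, Amer. J. Math. 90 (1968) — the
  Kolchin–Ostrowski theorem motivating the peeling.
-/

noncomputable section

open Set MeasureTheory
open Literature.NumberTheory.Transcendental Literature.ModelTheory.ExponentialFields

namespace Summit.KontsevichZagierPeriods.LiouvilleUnfolding.LogPrimitiveNL

/-- **Fréchet derivative of a log-linear expression.** At a point `x` where `φᵢ, Wᵢ, P` are
differentiable and `Wᵢ x ≠ 0`, `P x ≠ 0`, the function `y ↦ Σᵢ φᵢ y · log (Wᵢ y) + log (P y)` has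
Fréchet derivative `Σᵢ (φᵢ x • (Wᵢ x)⁻¹ • DWᵢ + log (Wᵢ x) • Dφᵢ) + (P x)⁻¹ • DP`
(sum rule, product rule, `HasFDerivAt.log`). -/
theorem peel_hasFDerivAt_sum_mul_log_add_log {n k : ℕ} (φ W : Fin k → (Fin n → ℝ) → ℝ)
    (P : (Fin n → ℝ) → ℝ) (x : Fin n → ℝ) (hφ : ∀ i, DifferentiableAt ℝ (φ i) x)
    (hW : ∀ i, DifferentiableAt ℝ (W i) x) (hW0 : ∀ i, W i x ≠ 0) (hP : DifferentiableAt ℝ P x)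
    (hP0 : P x ≠ 0) :
    HasFDerivAt (fun y => ∑ i, φ i y * Real.log (W i y) + Real.log (P y))
      (∑ i, (φ i x • ((W i x)⁻¹ • fderiv ℝ (W i) x) +
          Real.log (W i x) • fderiv ℝ (φ i) x) + (P x)⁻¹ • fderiv ℝ P x) x := by
  refine HasFDerivAt.add (HasFDerivAt.fun_sum fun i _ => ?_) (hP.hasFDerivAt.log hP0)
  exact (hφ i).hasFDerivAt.mul ((hW i).hasFDerivAt.log (hW0 i))

/-- **Peeling step** (registered stub `stub_peelingStep` of crux stmt-KontsevichZagierPeriods-2836,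
line `logderiv-peeling`): one base-derivative of a normalised log-linear relation
`Σ φᵢ log Wᵢ + log P = γ` on an open `ℚ`-semialgebraic `U` with differentiable `ℚ`-semialgebraic
data. (a) The partials `∂ⱼφᵢ = fderiv ℝ (φ i) · (Pi.single j 1)` are `ℚ`-semialgebraic on `U`
(Basu–Pollack–Roy 2006, Prop. 3.22: `IsSemialgebraicFunOn.fderiv_apply_single`); (b) so is the new
right-hand side `∂ⱼγ − Σᵢ φᵢ ∂ⱼWᵢ / Wᵢ − ∂ⱼP / P` (closure under `+, −, ×, /`, Bochnak–Coste–Roy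
1998, Prop. 2.2.6); (c) the differentiated identity
`Σᵢ ∂ⱼφᵢ log Wᵢ = ∂ⱼγ − Σᵢ φᵢ ∂ⱼWᵢ / Wᵢ − ∂ⱼP / P` holds on `U` (the two sides of the hypothesis
agree on the open `U`, so their Fréchet derivatives agree there; product rule and
`(log ∘ f)' = f'/f`). -/
theorem stub_peelingStep :
    ∀ (n k : ℕ) (U : Set (Fin n → ℝ)) (φ W : Fin k → (Fin n → ℝ) → ℝ) (P γ : (Fin n → ℝ) → ℝ)
      (j : Fin n), IsSemialgebraic ℚ U → IsOpen U → (∀ i, IsSemialgebraicFunOn ℚ U (φ i)) →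
      (∀ i, DifferentiableOn ℝ (φ i) U) → (∀ i, IsSemialgebraicFunOn ℚ U (W i)) →
      (∀ i, DifferentiableOn ℝ (W i) U) → (∀ i, ∀ x ∈ U, 0 < W i x) → IsSemialgebraicFunOn ℚ U P →
      DifferentiableOn ℝ P U → (∀ x ∈ U, 0 < P x) → IsSemialgebraicFunOn ℚ U γ →
      DifferentiableOn ℝ γ U → (∀ x ∈ U, ∑ i, φ i x * Real.log (W i x) + Real.log (P x) = γ x) →
      (∀ i, IsSemialgebraicFunOn ℚ U (fun x => fderiv ℝ (φ i) x (Pi.single j (1 : ℝ)))) ∧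
      IsSemialgebraicFunOn ℚ U (fun x => fderiv ℝ γ x (Pi.single j (1 : ℝ)) -
        ∑ i, φ i x * fderiv ℝ (W i) x (Pi.single j (1 : ℝ)) / W i x -
        fderiv ℝ P x (Pi.single j (1 : ℝ)) / P x) ∧
      (∀ x ∈ U, ∑ i, fderiv ℝ (φ i) x (Pi.single j (1 : ℝ)) * Real.log (W i x) =
        fderiv ℝ γ x (Pi.single j (1 : ℝ)) -
        ∑ i, φ i x * fderiv ℝ (W i) x (Pi.single j (1 : ℝ)) / W i x -
        fderiv ℝ P x (Pi.single j (1 : ℝ)) / P x) := by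
  intro n k U φ W P γ j hU hUo hφ hφd hW hWd hWpos hP hPd hPpos hγ hγd hid
  -- on the open set `U`, `DifferentiableOn` gives `DifferentiableAt` at every point
  have hφat : ∀ i, ∀ x ∈ U, DifferentiableAt ℝ (φ i) x := fun i x hx =>
    (hφd i).differentiableAt (hUo.mem_nhds hx)
  have hWat : ∀ i, ∀ x ∈ U, DifferentiableAt ℝ (W i) x := fun i x hx =>
    (hWd i).differentiableAt (hUo.mem_nhds hx)
  have hPat : ∀ x ∈ U, DifferentiableAt ℝ P x := fun x hx => hPd.differentiableAt (hUo.mem_nhds hx)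
  have hγat : ∀ x ∈ U, DifferentiableAt ℝ γ x := fun x hx => hγd.differentiableAt (hUo.mem_nhds hx)
  -- (a) partial derivatives of the data are `ℚ`-semialgebraic (BPR Prop. 3.22)
  have hφ' : ∀ i, IsSemialgebraicFunOn ℚ U (fun x => fderiv ℝ (φ i) x (Pi.single j (1 : ℝ))) :=
    fun i => (hφ i).fderiv_apply_single hUo (hφat i) j
  have hW' : ∀ i, IsSemialgebraicFunOn ℚ U (fun x => fderiv ℝ (W i) x (Pi.single j (1 : ℝ))) :=
    fun i => (hW i).fderiv_apply_single hUo (hWat i) j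
  have hP' : IsSemialgebraicFunOn ℚ U (fun x => fderiv ℝ P x (Pi.single j (1 : ℝ))) :=
    hP.fderiv_apply_single hUo hPat j
  have hγ' : IsSemialgebraicFunOn ℚ U (fun x => fderiv ℝ γ x (Pi.single j (1 : ℝ))) :=
    hγ.fderiv_apply_single hUo hγat j
  refine ⟨hφ', ?_, ?_⟩
  · -- (b) arithmetic closure (BCR Prop. 2.2.6)
    have hS : IsSemialgebraicFunOn ℚ U
        (fun x => ∑ i, φ i x * fderiv ℝ (W i) x (Pi.single j (1 : ℝ)) / W i x) :=
      IsSemialgebraicFunOn.fun_finsetSum Finset.univ hU fun i _ =>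
        ((hφ i).fun_mul (hW' i)).div (hW i) fun x hx => (hWpos i x hx).ne'
    exact (hγ'.fun_sub hS).fun_sub (hP'.div hP fun x hx => (hPpos x hx).ne')
  · -- (c) the differentiated identity
    intro x hx
    have hL := peel_hasFDerivAt_sum_mul_log_add_log φ W P x (fun i => hφat i x hx)
      (fun i => hWat i x hx) (fun i => (hWpos i x hx).ne') (hPat x hx) (hPpos x hx).ne'
    have hγL := hL.congr_of_eventuallyEq
      (Filter.eventuallyEq_of_mem (hUo.mem_nhds hx) fun y hy => (hid y hy).symm)
    rw [hγL.fderiv]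
    simp only [add_apply, sum_apply, smul_apply, smul_eq_mul]
    rw [Finset.sum_add_distrib]
    have h1 : ∑ i, φ i x * ((W i x)⁻¹ * fderiv ℝ (W i) x (Pi.single j (1 : ℝ))) =
        ∑ i, φ i x * fderiv ℝ (W i) x (Pi.single j (1 : ℝ)) / W i x :=
      Finset.sum_congr rfl fun i _ => by ring
    have h2 : ∑ i, Real.log (W i x) * fderiv ℝ (φ i) x (Pi.single j (1 : ℝ)) =
        ∑ i, fderiv ℝ (φ i) x (Pi.single j (1 : ℝ)) * Real.log (W i x) :=
      Finset.sum_congr rfl fun i _ => mul_comm _ _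
    rw [h1, h2]
    ring

end Summit.KontsevichZagierPeriods.LiouvilleUnfolding.LogPrimitiveNL

end
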